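import Summits.BirchSwinnertonDyer.Rank1Residual.GaloisImage.PropagatedConditionKummer
import Summits.BirchSwinnertonDyer.Rank1Residual.GaloisImage.PropagatedStructure
import HarnessLib

/-!
# `𝓕_can(E[p])_v = 𝓛_v` at a finite place `v ∤ p` with bounded `p`-power torsion in `H¹(ℚ_v, E)`:
# the propagated canonical condition EQUALS the local Kummer condition (the "index-zero" local
# lemma (Lℓ) of the core-rank computation; cell `b2b-bsdres`, team n1011, seat n1011-p06 gen 2 as
# delegate of n1011-p13's row T-a3-F1 — FIXED SIGNATURE of p13, INBOX 2026-08-21T07:20Z)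

HONEST FRAMING (cell `b2b-bsdres`, run/shared/lean/b2b/bsd-rank1-residual/, verbatim in every
file): the goal of the cell is to DELETE the COMBINATION-SHAPED residual classes of the
Birch–Swinnerton-Dyer formula for ALL analytic-rank `≤ 1` elliptic curves over `ℚ` — "full BSD
formula for every rank `≤ 1` curve in class `C`" assembled STRICTLY from published theorems — so
that the rank-`≤ 1` remainder becomes exactly the CONSTRUCTION-SHAPED classes, which are TYPED
(missing-input `Prop`s), NOT attempted. This is not "finishing BSD". Team n1011 (X4 ∧ `p = 3`,
§I N11; row T-a3-F1, the hypothesis side of Sakamoto 2024 Thm. 4.4 for `(E[3^m], 𝓕_can)`):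
research route; theorems only; no definition, no named fact; nothing booked; no label changes.

## What

For `E/ℚ` (`W`, elliptic), a prime `p` and a finite place `v`, n1011-p18's
`kummerSelmerStructure_le_propagatedSelmerStructureOne` (`PropagatedConditionKummer.lean`, decl of
record per lead R5-22) gives `𝓛_v ≤ 𝓕_can(E[p])_v` (local Kummer condition ≤ propagated canonical
condition `im(H¹(ℚ_v, T_pE) → H¹(ℚ_v, E[p]))`). This file proves the REVERSE inclusion under the
hypothesis `hbd` that the `p`-power torsion of `H¹(ℚ_v, E(ℚ̄_v))` has bounded exponent `p^N` (true at
`v ∤ p`: `H¹(ℚ_v, E)[p^∞]` is dual to `E(ℚ_v) ⊗ ℤ_p`-data and finite there — discharged elsewhere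
from the tree's local counts; here it is the explicit binder p13 fixed), and the equality:

* `propagatedSelmerStructureOne_le_kummerSelmerStructure_inr`: `𝓕_can(E[p])_v ≤ 𝓛_v`;
* `propagatedSelmerStructureOne_inr_eq_kummerSelmerStructure`: `𝓕_can(E[p])_v = 𝓛_v`.

PROOF (p13's route, skel/T-a3-F1-CR.md §2 (Lℓ)): `x ∈ 𝓕_can(E[p])_v` is `π_{1,*}[η]` for a
continuous crossed homomorphism `η : Γ_{ℚ_v} → T_pE` (`mem_propagatedSelmerStructureOne_iff`,
`oneCocycleClass_surjective`, `tateLocalMapOne_oneCocycleClass`); its image in `H¹(ℚ_v, E(ℚ̄_v))` is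
the class of `g ↦ (η g)_1 ∈ E(ℚ̄_v)` (`map_torsionPointsMapIntertwining_oneCocycleClass`), which equals
`p^N •` the class of `g ↦ (η g)_{N+1}` since `p^N • a_{N+1} = a_1` on `T_pE`
(`TateModule.pow_smul_proj_self_add`); the latter class is killed by `p^{N+1}` (its cocycle takes
values in `E[p^{N+1}]`), hence by `p^N` (`hbd`); so the image of `x` is `0`, i.e. `x ∈ 𝓛_v`
(`mem_kummerLocalConditionAt_iff`). The hypothesis `v ∤ p` (`hv`) is carried for the signature of
record and is not used by this argument (the content sits in `hbd`).

References: B. Mazur, K. Rubin, Mem. AMS 799 (2004) Def. 3.2.1, Lemma 3.7.1; K. Rubin, PCMS 18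
(2011) §3.1 [Rubin2011]; R. Sakamoto, JTNB 36 (2024) Def. 3.5–3.8 [Sakamoto2024]; J. H. Silverman,
*AEC* III.§7, VIII.§2, X.§4 [SilvermanAEC2009]; J. S. Milne, *ADT* I.§3 [MilneADT2006].
-/

noncomputable section

open scoped Classical NumberField ContRepresentation
open Field NumberField IsDedekindDomain
open WeierstrassCurve Literature.NumberTheory.EllipticCurves Literature.NumberTheory.GaloisRepresentations
  Literature.NumberTheory.GaloisRepresentations.DiscreteGaloisModule

namespace Summit.BirchSwinnertonDyer.Rank1Residual.GaloisImage

/-- **`𝓕_can(E[p])_v ≤ 𝓛_v` at a finite place with bounded `p`-power torsion in `H¹(ℚ_v, E)`.**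
For `x = π_{1,*}[η] ∈ 𝓕_can(E[p])_v` (`η : Γ_{ℚ_v} → T_pE` a continuous crossed homomorphism), the
image of `x` in `H¹(ℚ_v, E(ℚ̄_v))` is `p^N •` the class of `g ↦ (η g)_{N+1}`, a `p^{N+1}`-torsion
class, hence `0` by `hbd`; so `x` lies in the local Kummer condition. (`hv : v ∤ p` is part of the
signature of record — n1011-p13, T-a3-F1 (Lℓ) — and unused by the argument.)
[cite: Rubin2011, §3.1 (p. 29)] [cite: SilvermanAEC2009, III.§7 and X.§4] -/
theorem propagatedSelmerStructureOne_le_kummerSelmerStructure_inr (W : WeierstrassCurve ℚ)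
    [W.IsElliptic] (p : ℕ) [Fact p.Prime] (v : HeightOneSpectrum (𝓞 ℚ))
    (_hv : ((p : ℕ) : 𝓞 ℚ) ∉ v.asIdeal)
    (hbd : ∃ N : ℕ, ∀ c : galoisCohomology (W.localGaloisModule
        (Place.Completion (Sum.inr v : Place ℚ))) 1,
      (∃ k : ℕ, ((p ^ k : ℕ) : ℤ) • c = 0) → ((p ^ N : ℕ) : ℤ) • c = 0) :
    propagatedSelmerStructureOne W p (Sum.inr v) ≤ W.kummerSelmerStructure (p : ℤ) (Sum.inr v) := by
  set E := Place.Completion (Sum.inr v : Place ℚ) with hE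
  obtain ⟨N, hN⟩ := hbd
  intro x hx
  -- `x = π_{1,*}[η]`
  obtain ⟨y, rfl⟩ := (mem_propagatedSelmerStructureOne_iff W p (Sum.inr v) x).mp hx
  obtain ⟨η, rfl⟩ := oneCocycleClass_surjective (tateLocalRep W p (Sum.inr v)).toTopRep y
  rw [tateLocalMapOne_oneCocycleClass]
  -- the goal lives in `𝓛_E = ker (H¹(Γ_E, E[p]) → H¹(Γ_E, E(ℚ̄_v)))`, `E = ℚ_v`
  refine (W.mem_kummerLocalConditionAt_iff (p : ℤ) E _).mpr ?_
  have hmap := W.map_torsionPointsMapIntertwining_oneCocycleClass (p : ℤ) E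
    (pushCocycleOne W p (Sum.inr v) η)
  erw [hmap]
  -- the two cocycles `g ↦ (η g)_1` and `g ↦ (η g)_{N+1}` with values in `E(ℚ̄_v)`
  set Y : TopRep ℤ (absoluteGaloisGroup E) := discreteTopRep (absoluteGaloisGroup E) (localPoints W E)
    with hY
  set ψ₁ := contOneCocycles.pullback (ContinuousMonoidHom.id (absoluteGaloisGroup E))
      (X := DiscreteGaloisModule.toTopRep (GaloisRep.restrictField E (W.torsionGaloisModule (p : ℤ))))
      (Y := Y)
      (TopRep.ofHom ⟨(W.torsionPointsMapIntertwining (p : ℤ) E).toContinuousLinearMap,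
        (W.torsionPointsMapIntertwining (p : ℤ) E).isIntertwining'⟩) (pushCocycleOne W p (Sum.inr v) η)
    with hψ₁
  set ψN := contOneCocycles.pullback (ContinuousMonoidHom.id (absoluteGaloisGroup E))
      (X := DiscreteGaloisModule.toTopRep
        (GaloisRep.restrictField E (W.torsionGaloisModule ((p : ℤ) ^ N * (p : ℤ)))))
      (Y := Y)
      (TopRep.ofHom ⟨(W.torsionPointsMapIntertwining ((p : ℤ) ^ N * (p : ℤ)) E).toContinuousLinearMap,
        (W.torsionPointsMapIntertwining ((p : ℤ) ^ N * (p : ℤ)) E).isIntertwining'⟩)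
      (pushCocycle W p N (Sum.inr v) η)
    with hψN
  have hψ₁_apply : ∀ g, ψ₁.1 g = pointsMap W E (TateModule.proj p 1 (η.1 g)) := fun g => rfl
  have hψN_apply : ∀ g, ψN.1 g = pointsMap W E (TateModule.proj p (N + 1) (η.1 g)) := fun g => rfl
  -- `ψ₁ = p^N • ψN`
  have hrel : ψ₁ = ((p ^ N : ℕ) : ℤ) • ψN := by
    refine Subtype.ext (ContinuousMap.ext fun g => ?_)
    change ψ₁.1 g = ((p ^ N : ℕ) : ℤ) • ψN.1 g
    rw [hψ₁_apply, hψN_apply, ← map_zsmul, natCast_zsmul, TateModule.pow_smul_proj_self_add N 1]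
  -- `p^{N+1} • ψN = 0` (values in `E[p^{N+1}]`), hence `p^{N+1} • [ψN] = 0`
  have h0 : ((p ^ (N + 1) : ℕ) : ℤ) • ψN = 0 := by
    refine Subtype.ext (ContinuousMap.ext fun g => ?_)
    change ((p ^ (N + 1) : ℕ) : ℤ) • ψN.1 g = 0
    rw [hψN_apply, ← map_zsmul]
    have hmem := proj_succ_mem_geomTorsion W p N (η.1 g)
    rw [mem_geomTorsion_iff, ← pow_succ, ← Nat.cast_pow] at hmem
    rw [hmem, map_zero]
  -- the `ℤ`-module scalar action on classes (`oneCocycleClass_smul`) vs the group `zsmul` of `hbd`: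
  -- `int_smul_eq_zsmul`
  have hmodN : _ := congrArg (oneCocycleClass Y) h0
  rw [oneCocycleClass_smul, oneCocycleClass_zero] at hmodN
  have htors : ((p ^ (N + 1) : ℕ) : ℤ) • oneCocycleClass Y ψN = 0 :=
    (int_smul_eq_zsmul (continuousCohomology 1 Y).toModuleCat.isModule _ _).symm.trans hmodN
  -- hence `p^N • [ψN] = 0` by `hbd`
  have hkill : ((p ^ N : ℕ) : ℤ) • oneCocycleClass Y ψN = 0 := hN (oneCocycleClass Y ψN) ⟨N + 1, htors⟩
  -- and `[ψ₁] = p^N • [ψN] = 0`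
  have hmod1 : _ := congrArg (oneCocycleClass Y) hrel
  rw [oneCocycleClass_smul] at hmod1
  rw [hmod1]
  exact (int_smul_eq_zsmul (continuousCohomology 1 Y).toModuleCat.isModule _ _).trans hkill

/-- **`𝓕_can(E[p])_v = 𝓛_v`** (same binders): the reverse inclusion above together with n1011-p18's
`kummerSelmerStructure_le_propagatedSelmerStructureOne` (decl of record, R5-22). The "index zero at
`ℓ ≠ p`" input of the core-rank count `χ(𝓕̄_can) = 1` (n1011-p13, skel/T-a3-F1-CR.md).
[cite: Rubin2011, §3.1 (p. 29)] [cite: Sakamoto2024, Def. 3.6 (p. 923)] -/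
theorem propagatedSelmerStructureOne_inr_eq_kummerSelmerStructure (W : WeierstrassCurve ℚ)
    [W.IsElliptic] (p : ℕ) [Fact p.Prime] (v : HeightOneSpectrum (𝓞 ℚ))
    (hv : ((p : ℕ) : 𝓞 ℚ) ∉ v.asIdeal)
    (hbd : ∃ N : ℕ, ∀ c : galoisCohomology (W.localGaloisModule
        (Place.Completion (Sum.inr v : Place ℚ))) 1,
      (∃ k : ℕ, ((p ^ k : ℕ) : ℤ) • c = 0) → ((p ^ N : ℕ) : ℤ) • c = 0) :
    propagatedSelmerStructureOne W p (Sum.inr v) = W.kummerSelmerStructure (p : ℤ) (Sum.inr v) :=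
  le_antisymm (propagatedSelmerStructureOne_le_kummerSelmerStructure_inr W p v hv hbd)
    (kummerSelmerStructure_le_propagatedSelmerStructureOne W p (Sum.inr v))

end Summit.BirchSwinnertonDyer.Rank1Residual.GaloisImage

end
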